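import Summits.HodgeConjecture.HodgeCM.PerL34.Li92Bridge_1

/-! PORT of `HodgeCM/PerL34/Li92Bridge.lean` (HodgeCMPerL run 82) — part 2: continuation of `Summits.HodgeConjecture.HodgeCM.PerL34.Li92Bridge_1` (split at a top-level declaration boundary by port_pkg.py; scope re-opened below; declarations unchanged). -/

-- port_pkg: scope re-opened for this part (file-level context, then the namespace/section stack open at the cut)
set_option autoImplicit false
noncomputable section
namespace HodgeCM
namespace PerL34
namespace Li92Route
open HodgeCM.Prior.Perl34File
open HodgeCM.PerL34.Schur
open HodgeCM.PerL34.EulerProduct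
open HodgeCM.Literature.Theta
variable {HG : Type*} [NormedAddCommGroup HG] [InnerProductSpace ℂ HG] [CompleteSpace HG]
section Model
variable {U : Universe} (T : U.ThetaModel)
/-- **ROUTE A ⇒ pv13's cluster interface** (`CharsAssembly.ClusterOutputs`), hence everything downstream of it. -/
theorem clusterOutputs_of_analytic (h : AnalyticInputs T) : ClusterOutputs T := by
  intro L ι₁ V c hc
  obtain ⟨A, Pl, ⟨S12⟩, ⟨S34⟩⟩ := h V c hc
  exact ⟨Pl, ⟨S12.toSideOutputs⟩, ⟨S34.toSideOutputs⟩⟩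

/-- Route A ⇒ the carver's `N31_chars T` (Lemma 4.2(b) as typed). -/
theorem N31_of_analytic (h : AnalyticInputs T) : N31_chars T :=
  N31_of_cluster T (clusterOutputs_of_analytic T h)

/-- Route A ⇒ the realisation interface's open input A9 `Open_chars`. -/
theorem open_chars_of_analytic (h : AnalyticInputs T) : T.Open_chars :=
  open_chars_of_cluster T (clusterOutputs_of_analytic T h)

/-- **ROUTE B ⇒ `Open_chars`** (= `N31_chars T` by `Iff.rfl`): Lemma 4.2(b) for the model from [Li92 Cor 5.5] +
dictionary + the archimedean input alone. -/
theorem open_chars_of_print (h : PrintInputs T) : T.Open_chars := by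
  intro L ι₁ V c hc
  obtain ⟨A, ⟨S12⟩, ⟨S34⟩⟩ := h V c hc
  exact ⟨S12.allowed_all, S34.allowed_all⟩

/-- Route B ⇒ the carver's `N31_chars T`. -/
theorem N31_of_print (h : PrintInputs T) : N31_chars T :=
  open_chars_of_print T h

end Model

/-! ### Non-vacuity over the prior one-point torus -/

namespace Smoke

/-- A Li-datum with PerL's parameters `(3, 1, 2, 1)` and every predicate `True`: [Cor 5.5] holds trivially. -/
def liDatum : Li92GlobalDatum.{0} where
  Pl := Unit
  arch := Set.univ
  Irr := fun _ => Unit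
  ds := fun _ _ => True
  occ := fun _ _ => True
  occIrr := fun _ _ => True
  stable := fun _ => True
  Cusp := Unit
  loc := fun _ _ => ()
  thetaNe := fun _ => True
  thetaIrr := fun _ => True
  howe := fun _ _ => True
  n := 3
  n' := 1
  d := 2
  d₀ := 1

/-- (Ported verbatim from the HodgeCMPerL package; no docstring in the source.) -/
theorem liDatum_cor55 : liDatum.StableRangeNonvanishing :=
  fun _ _ _ => ⟨⟨fun _ _ _ => trivial, fun _ => trivial⟩, fun _ => ⟨trivial, fun _ => trivial⟩⟩

/-- (Ported verbatim from the HodgeCMPerL package; no docstring in the source.) -/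
theorem liDatum_thm54a : liDatum.StableRangeLocal :=
  ⟨fun _ _ _ => ⟨trivial, trivial⟩, fun _ _ _ => trivial⟩

/-- The ambient on `HG = ℂ`: no operators, every subspace "in `𝒜^{1,0}`". -/
def ambient : Ambient ℂ where
  act := ∅
  InA10 := fun _ => True

/-- The closure of `⊤` is `⊤`. -/
theorem closure_top : (⊤ : Submodule ℂ ℂ).topologicalClosure = ⊤ :=
  top_le_iff.mp (Submodule.le_topologicalClosure ⊤)

/-- A line dictionary over the one-point torus: `Θ = {1}`, `V(θ) = ⊤ = ℂ`. -/
def line : LineDict ambient Unit where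
  G := liDatum
  cor55 := liDatum_cor55
  n_eq := rfl
  n'_eq := rfl
  d_eq := rfl
  d₀_eq := rfl
  cusp := fun _ => ()
  ds_arch := fun _ _ _ => trivial
  Theta := fun _ => {1}
  Vθ := fun _ => ⊤
  Theta_sub := fun _ _ _ => Submodule.mem_top
  Vθ_le := fun _ => by
    rw [Perl34.SmokeS4.closure_span_eq_top_of_one_mem {1} rfl]
  Vθ_inv := fun _ _ h => h.elim
  thetaNe_iff := fun _ => ⟨fun _ => top_ne_bot, fun _ => trivial⟩
  irr_of_thetaIrr := fun _ _ K _ _ _ => by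
    rw [closure_top]
    exact Ideal.eq_bot_or_top K
  inA10_of_howe := fun _ _ _ => trivial

/-- The side dictionary over the one-point torus (`allowed ≡ True`). -/
def side : SideDict ambient Perl34.SmokeS4.torus where
  line₁ := line
  line₂ := line
  allowed_of := fun _ _ _ => trivial

/-- Route B is inhabited … -/
def occSide : OccSide ambient Perl34.SmokeS4.torus where
  toSideDict := side
  occ₁ := fun _ _ _ => trivial
  occ₂ := fun _ _ _ => trivial

/-- … and fires. -/
theorem allowed_all_occ : ∀ χ : Perl34.SmokeS4.torus.X, Perl34.SmokeS4.torus.allowed χ :=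
  occSide.allowed_all

/-- Route A is inhabited (with the landed toy `LocalFactorDatum` of `EulerProductSmoke`, theta vector `1 ∈ ⊤`) … -/
def analyticSide : AnalyticSide ambient Perl34.SmokeS4.torus ℕ where
  toSideDict := side
  fst := fun _ => EulerProduct.Smoke.datum
  snd := fun _ => EulerProduct.Smoke.datum
  fst_mem := fun _ => Submodule.mem_top
  snd_mem := fun _ => Submodule.mem_top

/-- … and fires: the rebuilt `SideOutputs` yields "every character is allowed". -/
theorem allowed_all_analytic : ∀ χ : Perl34.SmokeS4.torus.X, Perl34.SmokeS4.torus.allowed χ :=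
  analyticSide.allowed_all

/-- Definition 3.2's clause for the toy line holds by the kernel route (one constituent = `⊤`). -/
theorem lineAllowed_smoke : ambient.LineAllowed (line.Theta ()) :=
  line.lineAllowed_of_occ () fun _ _ => trivial

end Smoke

end Li92Route
end PerL34
end HodgeCM

end
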